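import Mathlib
import HarnessLib
import Summits.MatrixMultiplication.MatrixMultiplication.Theses.BrentRefutationDepth
import Literature.Computability.AlgebraicComplexity.MatrixMultiplicationExponent
import Literature.Computability.AlgebraicComplexity.PowerSumNonvanishing

/-!
# MatrixMultiplication / BrentRefutationDepth — the Nullstellensatz floor `NSDepthLowerBound`

Route `BrentRefutationDepth`, item `stmt-MatrixMultiplication-5586` (support, rank 9):
a Nullstellensatz refutation `∑_{ijk} g_{ijk} · B_{ijk} = 1` of the Brent system `B(n, r)`
(`B_{ijk} = ∑_{t<r} a_{t,i} b_{t,j} c_{t,k} − ⟨n,n,n⟩_{ijk}`, unknowns `X (0,t,i) = a_{t,i}`,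
`X (1,t,j) = b_{t,j}`, `X (2,t,k) = c_{t,k}`) over `ℂ` whose multipliers have total degree `≤ D`
forces `r ≤ 2 D + 5`.  We prove the sharper, unconditional bound `r ≤ D`
(`le_of_brent_refutation`): over a field of characteristic `0` no fact from proof complexity
(Razborov's polynomial-calculus degree bound for the pigeonhole principle, which the route's
informal text invokes and which is needed only in positive characteristic) is required.

## Proof (symmetric design pulled back along the pigeonhole reduction)

* **Reduction.** Let `P = Fin n × Fin n × Fin n` index the `n³` triads of the standard
  algorithm, `⟨n,n,n⟩ = ∑_J x_J ⊗ y_J ⊗ z_J` (`sum_std_triads`).  The algebra map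
  `Φ : a_{t,i} ↦ ∑_J x_J(i) · p_{J,t}` (similarly for `b`, `c`) into the polynomial ring on the
  "pigeonhole" variables `p_{J,t}` (`J ∈ P` a pigeon, `t < r` a hole) is induced by linear forms,
  so it does not raise total degrees.
* **Design.** On `ℂ[p_{J,t}]` the linear functional `E` with
  `E(p^μ) = 1 / (r (r-1) ⋯ (r-k+1))` if the support of `μ` is a partial matching with `k` edges
  between pigeons and holes, and `E(p^μ) = 0` otherwise (`exists_design`), satisfies `E 1 = 1`,
  kills every multiple of a hole collision `p_{J,t} p_{J',t}` (`J ≠ J'`), identifies `p²` with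
  `p`, and satisfies the pigeon identity `∑_t E(h · p_{J,t}) = E(h)` whenever every monomial of `h`
  involves fewer than `r` variables (`sum_symmWeight_insert`: a matching with `k < r` edges not
  covering `J` extends to exactly `r - k` holes, and `(r-k) / (r ⋯ (r-k)) = 1 / (r ⋯ (r-k+1))`).
* **Kill.** Consequently `E (h · Φ(B_{ijk})) = (∑_J x_J(i) y_J(j) z_J(k) − ⟨n,n,n⟩_{ijk}) · E(h) = 0`
  for every `h` of total degree `< r` (`design_master`), so applying `E ∘ Φ` to a refutation with
  `D < r` gives `0 = 1`.

The file declares no definitions: the design is produced by an existence theorem and consumed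
through its four properties.
-/

open MvPolynomial
open scoped BigOperators

-- the tree's namespace `Summit.MatrixMultiplication.MatrixMultiplication.…` repeats a component by design
set_option linter.dupNamespace false

namespace Summit.MatrixMultiplication.MatrixMultiplication.Theorems

namespace NSDepth

/-! ### The symmetric pigeonhole design -/

section Combinatorics

variable {P : Type*} [DecidableEq P] {r : ℕ}

/-- **Pigeon identity for the symmetric weight.** Let `wt S = 1 / r^{(|S|)}` (falling factorial)
when `S ⊆ P × Fin r` is a partial matching (no two pairs share a pigeon or a hole) and `wt S = 0`
otherwise. If `|S| < r` then for every pigeon `J`, `∑_t wt (insert (J,t) S) = wt S`: either `J` is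
already matched (one surviving term), or exactly the `r - |S|` free holes contribute
`1 / r^{(|S|+1)}` each. [folklore] -/
theorem sum_symmWeight_insert (wt : Finset (P × Fin r) → ℂ)
    (hwt : ∀ S, wt S =
      if (∀ a ∈ S, ∀ b ∈ S, a.1 = b.1 → a = b) ∧ (∀ a ∈ S, ∀ b ∈ S, a.2 = b.2 → a = b)
      then ((r.descFactorial S.card : ℕ) : ℂ)⁻¹ else 0)
    (S : Finset (P × Fin r)) (hS : S.card < r) (J : P) :
    ∑ t : Fin r, wt (insert (J, t) S) = wt S := by
  classical
  by_cases hM : (∀ a ∈ S, ∀ b ∈ S, a.1 = b.1 → a = b) ∧ (∀ a ∈ S, ∀ b ∈ S, a.2 = b.2 → a = b)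
  swap
  · -- `S` is not a matching, hence neither is any superset
    have h0 : ∀ t, wt (insert (J, t) S) = 0 := by
      intro t
      rw [hwt, if_neg]
      rintro ⟨h1, h2⟩
      exact hM ⟨fun a ha b hb => h1 a (Finset.mem_insert_of_mem ha) b (Finset.mem_insert_of_mem hb),
        fun a ha b hb => h2 a (Finset.mem_insert_of_mem ha) b (Finset.mem_insert_of_mem hb)⟩
    rw [hwt S, if_neg hM]
    exact Finset.sum_eq_zero fun t _ => h0 t
  obtain ⟨hM1, hM2⟩ := hM
  by_cases hJ : ∃ t₀, (J, t₀) ∈ S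
  · -- `J` already matched to `t₀`: only the term `t = t₀` survives
    obtain ⟨t₀, ht₀⟩ := hJ
    rw [Finset.sum_eq_single t₀]
    · rw [Finset.insert_eq_of_mem ht₀]
    · intro t _ ht
      rw [hwt, if_neg]
      rintro ⟨h1, -⟩
      have h := h1 (J, t) (Finset.mem_insert_self _ _) (J, t₀) (Finset.mem_insert_of_mem ht₀) rfl
      exact ht (Prod.mk.inj h).2
    · intro h
      exact absurd (Finset.mem_univ t₀) h
  · -- `J` unmatched: the free holes are those outside `T = snd '' S`
    push Not at hJ
    set T : Finset (Fin r) := S.image Prod.snd with hT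
    have hTcard : T.card = S.card :=
      Finset.card_image_of_injOn fun a ha b hb h => hM2 a ha b hb h
    have key : ∀ t, wt (insert (J, t) S) =
        if t ∈ T then 0 else ((r.descFactorial (S.card + 1) : ℕ) : ℂ)⁻¹ := by
      intro t
      split_ifs with ht
      · obtain ⟨a, haS, hat⟩ := Finset.mem_image.mp ht
        rw [hwt, if_neg]
        rintro ⟨-, h2⟩
        have h := h2 (J, t) (Finset.mem_insert_self _ _) a (Finset.mem_insert_of_mem haS) hat.symm
        apply hJ t
        rw [h]
        exact haS
      · rw [hwt, if_pos, Finset.card_insert_of_notMem (hJ t)]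
        refine ⟨?_, ?_⟩
        · intro a ha b hb hab
          rw [Finset.mem_insert] at ha hb
          rcases ha with rfl | ha <;> rcases hb with rfl | hb
          · rfl
          · exact absurd (show (J, b.2) ∈ S by rw [show (J, b.2) = b from Prod.ext hab rfl]; exact hb)
              (hJ b.2)
          · exact absurd (show (J, a.2) ∈ S by
              rw [show (J, a.2) = a from Prod.ext hab.symm rfl]; exact ha) (hJ a.2)
          · exact hM1 a ha b hb hab
        · intro a ha b hb hab
          rw [Finset.mem_insert] at ha hb
          rcases ha with rfl | ha <;> rcases hb with rfl | hb
          · rfl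
          · exact absurd (show t ∈ T by rw [show t = b.2 from hab]; exact Finset.mem_image_of_mem _ hb) ht
          · exact absurd (show t ∈ T by
              rw [show t = a.2 from hab.symm]; exact Finset.mem_image_of_mem _ ha) ht
          · exact hM2 a ha b hb hab
    rw [Finset.sum_congr rfl fun t _ => key t, Finset.sum_ite, Finset.sum_const_zero, zero_add,
      Finset.sum_const, nsmul_eq_mul]
    have hc : (Finset.univ.filter fun t : Fin r => ¬ t ∈ T) = Tᶜ := by
      ext t
      simp
    rw [hc, Finset.card_compl, Fintype.card_fin, hTcard, hwt S, if_pos ⟨hM1, hM2⟩,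
      Nat.descFactorial_succ, Nat.cast_mul, mul_inv, ← mul_assoc]
    have hne : ((r - S.card : ℕ) : ℂ) ≠ 0 := by
      exact_mod_cast Nat.sub_ne_zero_of_lt hS
    rw [mul_inv_cancel₀ hne, one_mul]

end Combinatorics

section Design

variable (P : Type*) [DecidableEq P] (r : ℕ)

/-- **The symmetric Nullstellensatz design for `PHP^P_r` over `ℂ`.** There is a `ℂ`-linear
functional `E` on `ℂ[p_{J,t} : J ∈ P, t < r]` with `E 1 = 1` which (i) kills every multiple of a
hole collision `p_{J,t} p_{J',t}`, `J ≠ J'`; (ii) identifies `p_{J,t}²` with `p_{J,t}` inside any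
product; (iii) satisfies the pigeon identity `∑_t E(h p_{J,t}) = E h` for every `h` all of whose
monomials involve fewer than `r` variables. (It is `E(p^μ) = 1/r^{(k)}` on monomials whose support
is a partial matching with `k` edges, `0` otherwise; characteristic `0` is used to invert the
falling factorials.) [folklore] -/
theorem exists_design :
    ∃ E : MvPolynomial (P × Fin r) ℂ →ₗ[ℂ] ℂ,
      E 1 = 1 ∧
      (∀ (h : MvPolynomial (P × Fin r) ℂ) (J J' : P) (t : Fin r), J ≠ J' →
        E (h * (X (J, t) * X (J', t))) = 0) ∧
      (∀ (h : MvPolynomial (P × Fin r) ℂ) (v : P × Fin r), E (h * (X v * X v)) = E (h * X v)) ∧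
      (∀ (h : MvPolynomial (P × Fin r) ℂ) (J : P), (∀ μ ∈ h.support, μ.support.card < r) →
        ∑ t : Fin r, E (h * X (J, t)) = E h) := by
  classical
  -- the symmetric weight on supports
  set wt : Finset (P × Fin r) → ℂ := fun S =>
    if (∀ a ∈ S, ∀ b ∈ S, a.1 = b.1 → a = b) ∧ (∀ a ∈ S, ∀ b ∈ S, a.2 = b.2 → a = b)
      then ((r.descFactorial S.card : ℕ) : ℂ)⁻¹ else 0 with hwt_def
  have hwt : ∀ S, wt S =
      if (∀ a ∈ S, ∀ b ∈ S, a.1 = b.1 → a = b) ∧ (∀ a ∈ S, ∀ b ∈ S, a.2 = b.2 → a = b)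
      then ((r.descFactorial S.card : ℕ) : ℂ)⁻¹ else 0 := fun S => rfl
  -- the functional, defined on the monomial basis
  set E : MvPolynomial (P × Fin r) ℂ →ₗ[ℂ] ℂ :=
    (MvPolynomial.basisMonomials (P × Fin r) ℂ).constr ℂ fun μ => wt μ.support with hE_def
  have hE1 : ∀ μ : P × Fin r →₀ ℕ, E (monomial μ (1 : ℂ)) = wt μ.support := by
    intro μ
    have h := Module.Basis.constr_basis (MvPolynomial.basisMonomials (P × Fin r) ℂ) ℂ
      (fun μ => wt μ.support) μ
    rwa [MvPolynomial.coe_basisMonomials] at h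
  have hE : ∀ (μ : P × Fin r →₀ ℕ) (c : ℂ), E (monomial μ c) = c * wt μ.support := by
    intro μ c
    have h : monomial μ c = c • monomial μ (1 : ℂ) := by
      rw [smul_monomial, smul_eq_mul, mul_one]
    rw [h, map_smul, hE1, smul_eq_mul]
  -- supports of shifted monomials
  have hsupp : ∀ (μ : P × Fin r →₀ ℕ) (v : P × Fin r),
      (μ + Finsupp.single v 1).support = insert v μ.support := by
    intro μ v
    ext b
    simp only [Finsupp.mem_support_iff, Finsupp.add_apply, Finsupp.single_apply, Finset.mem_insert]
    by_cases hb : v = b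
    · subst hb
      simp
    · simp only [if_neg hb, add_zero]
      exact ⟨Or.inr, fun h => h.resolve_left (Ne.symm hb)⟩
  have hmulX : ∀ (μ : P × Fin r →₀ ℕ) (c : ℂ) (v : P × Fin r),
      monomial μ c * X v = monomial (μ + Finsupp.single v 1) c := by
    intro μ c v
    rw [monomial_add_single, pow_one]
  refine ⟨E, ?_, ?_, ?_, ?_⟩
  · -- normalisation
    rw [MvPolynomial.one_def, hE, one_mul, Finsupp.support_zero, hwt, if_pos (by simp),
      Finset.card_empty, Nat.descFactorial_zero, Nat.cast_one, inv_one]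
  · -- hole collisions
    intro h J J' t hJ
    induction h using MvPolynomial.induction_on' with
    | monomial μ c =>
      rw [← mul_assoc, hmulX, hmulX, hE, hwt, if_neg, mul_zero]
      rintro ⟨-, h2⟩
      have hm1 : (J, t) ∈ (μ + Finsupp.single (J, t) 1 + Finsupp.single (J', t) 1).support := by
        rw [hsupp, hsupp]
        simp
      have hm2 : (J', t) ∈ (μ + Finsupp.single (J, t) 1 + Finsupp.single (J', t) 1).support := by
        rw [hsupp]
        simp
      exact hJ (congrArg Prod.fst (h2 _ hm1 _ hm2 rfl))
    | add p q hp hq => rw [add_mul, map_add, hp, hq, add_zero]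
  · -- Boolean axiom: `p²` and `p` have the same support
    intro h v
    induction h using MvPolynomial.induction_on' with
    | monomial μ c =>
      simp only [← mul_assoc, hmulX, hE, hsupp, Finset.insert_idem]
    | add p q hp hq => rw [add_mul, add_mul, map_add, map_add, hp, hq]
  · -- pigeon identity
    intro h J hh
    have hs : h = ∑ μ ∈ h.support, monomial μ (coeff μ h) := h.as_sum
    have lhs : ∀ t, E (h * X (J, t)) = ∑ μ ∈ h.support, coeff μ h * wt (insert (J, t) μ.support) := by
      intro t
      conv_lhs => rw [hs]
      rw [Finset.sum_mul, map_sum]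
      refine Finset.sum_congr rfl fun μ _ => ?_
      rw [hmulX, hE, hsupp]
    have rhs : E h = ∑ μ ∈ h.support, coeff μ h * wt μ.support := by
      conv_lhs => rw [hs]
      rw [map_sum]
      exact Finset.sum_congr rfl fun μ _ => hE _ _
    simp_rw [lhs]
    rw [rhs, Finset.sum_comm]
    refine Finset.sum_congr rfl fun μ hμ => ?_
    rw [← Finset.mul_sum, sum_symmWeight_insert wt hwt _ (hh μ hμ)]

end Design

section Consequences

variable {P : Type*} [Fintype P] {r : ℕ} (E : MvPolynomial (P × Fin r) ℂ →ₗ[ℂ] ℂ)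

/-- Linearity of a design against a linear form in the hole-`t` variables. [folklore] -/
theorem design_mul_lform (h : MvPolynomial (P × Fin r) ℂ) (u : P → ℂ) (t : Fin r) :
    E (h * ∑ J, u J • X (J, t)) = ∑ J, u J * E (h * X (J, t)) := by
  simp only [Finset.mul_sum, mul_smul_comm, map_sum, map_smul, smul_eq_mul]

/-- Two linear forms in the hole-`t` variables collapse to one under a design: collisions die and
squares are linearised, `E(h · ℓ_v ℓ_w) = E(h · ℓ_{vw})`. [folklore] -/
theorem design_collapse
    (hcoll : ∀ (h : MvPolynomial (P × Fin r) ℂ) (J J' : P) (t : Fin r), J ≠ J' →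
      E (h * (X (J, t) * X (J', t))) = 0)
    (hbool : ∀ (h : MvPolynomial (P × Fin r) ℂ) (v : P × Fin r), E (h * (X v * X v)) = E (h * X v))
    (h : MvPolynomial (P × Fin r) ℂ) (v w : P → ℂ) (t : Fin r) :
    E (h * ((∑ J, v J • X (J, t)) * ∑ J, w J • X (J, t))) =
      E (h * ∑ J, (v J * w J) • X (J, t)) := by
  rw [← mul_assoc, design_mul_lform, design_mul_lform]
  refine Finset.sum_congr rfl fun J' _ => ?_
  rw [mul_right_comm, design_mul_lform, Finset.sum_eq_single J']
  · have e : h * X (J', t) * X (J', t) = h * (X (J', t) * X (J', t)) := mul_assoc _ _ _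
    rw [e, hbool]
    ring
  · intro J _ hJ
    have e : h * X (J', t) * X (J, t) = h * (X (J', t) * X (J, t)) := mul_assoc _ _ _
    rw [e, hcoll _ _ _ _ (Ne.symm hJ), mul_zero]
  · intro h'
    exact absurd (Finset.mem_univ _) h'

/-- Three linear forms: `E(h · ℓ_u ℓ_v ℓ_w) = ∑_J u_J v_J w_J · E(h · p_{J,t})`. [folklore] -/
theorem design_triple
    (hcoll : ∀ (h : MvPolynomial (P × Fin r) ℂ) (J J' : P) (t : Fin r), J ≠ J' →
      E (h * (X (J, t) * X (J', t))) = 0)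
    (hbool : ∀ (h : MvPolynomial (P × Fin r) ℂ) (v : P × Fin r), E (h * (X v * X v)) = E (h * X v))
    (h : MvPolynomial (P × Fin r) ℂ) (u v w : P → ℂ) (t : Fin r) :
    E (h * ((∑ J, u J • X (J, t)) * (∑ J, v J • X (J, t)) * ∑ J, w J • X (J, t))) =
      ∑ J, (u J * v J * w J) * E (h * X (J, t)) := by
  have e1 : h * ((∑ J, u J • X (J, t)) * (∑ J, v J • X (J, t)) * ∑ J, w J • X (J, t)) =
      (h * ∑ J, u J • X (J, t)) * ((∑ J, v J • X (J, t)) * ∑ J, w J • X (J, t)) := by ring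
  rw [e1, design_collapse E hcoll hbool]
  have e2 : (h * ∑ J, u J • X (J, t)) * (∑ J, (v J * w J) • X (J, t)) =
      h * ((∑ J, u J • X (J, t)) * ∑ J, (v J * w J) • X (J, t)) := mul_assoc _ _ _
  rw [e2, design_collapse E hcoll hbool, design_mul_lform]
  exact Finset.sum_congr rfl fun J _ => by ring

/-- **Master identity.** For `h` all of whose monomials involve fewer than `r` variables,
`E(h · ∑_t ℓ_u^t ℓ_v^t ℓ_w^t) = (∑_J u_J v_J w_J) · E(h)`. [folklore] -/
theorem design_master
    (hcoll : ∀ (h : MvPolynomial (P × Fin r) ℂ) (J J' : P) (t : Fin r), J ≠ J' →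
      E (h * (X (J, t) * X (J', t))) = 0)
    (hbool : ∀ (h : MvPolynomial (P × Fin r) ℂ) (v : P × Fin r), E (h * (X v * X v)) = E (h * X v))
    (hpig : ∀ (h : MvPolynomial (P × Fin r) ℂ) (J : P), (∀ μ ∈ h.support, μ.support.card < r) →
      ∑ t : Fin r, E (h * X (J, t)) = E h)
    (h : MvPolynomial (P × Fin r) ℂ) (hh : ∀ μ ∈ h.support, μ.support.card < r) (u v w : P → ℂ) :
    E (h * ∑ t : Fin r, (∑ J, u J • X (J, t)) * (∑ J, v J • X (J, t)) * ∑ J, w J • X (J, t)) =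
      (∑ J, u J * v J * w J) * E h := by
  rw [Finset.mul_sum, map_sum]
  simp_rw [design_triple E hcoll hbool]
  rw [Finset.sum_comm, Finset.sum_mul]
  refine Finset.sum_congr rfl fun J _ => ?_
  rw [← Finset.mul_sum, hpig h J hh]

end Consequences

/-! ### The reduction for `⟨n,n,n⟩` -/

/-- The standard algorithm as a coordinate identity:
`⟨n,n,n⟩_{abc} = ∑_{(κ,μ,ν)} [a = (κ,ν)] [b = (κ,μ)] [c = (μ,ν)]` (Bläser 2013, §5). [folklore] -/
theorem sum_std_triads (n : ℕ) (a b c : Fin n × Fin n) :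
    ∑ J : Fin n × Fin n × Fin n,
      (if a = (J.1, J.2.2) then (1 : ℂ) else 0) * (if b = (J.1, J.2.1) then (1 : ℂ) else 0) *
        (if c = (J.2.1, J.2.2) then (1 : ℂ) else 0) =
      Literature.Computability.AlgebraicComplexity.matMulTensor ℂ n n n a b c := by
  obtain ⟨⟨a₁, a₂⟩, ⟨b₁, b₂⟩, ⟨c₁, c₂⟩⟩ := a, b, c
  rw [Fintype.sum_eq_single (a₁, b₂, a₂)]
  · simp only [Literature.Computability.AlgebraicComplexity.matMulTensor, Prod.mk.injEq]
    by_cases h₁ : a₁ = b₁ <;> by_cases h₂ : b₂ = c₁ <;> by_cases h₃ : a₂ = c₂ <;>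
      simp [h₁, h₂, h₃, eq_comm]
  · rintro ⟨κ, μ, ν⟩ hne
    simp only [Prod.mk.injEq]
    by_cases hκ : a₁ = κ ∧ a₂ = ν
    · by_cases hμ : b₁ = κ ∧ b₂ = μ
      · exfalso
        apply hne
        rw [hκ.1, hκ.2, hμ.2]
      · simp [hμ]
    · simp [hκ]

/-- A linear combination of variables has total degree `≤ 1`. [folklore] -/
theorem totalDegree_sum_smul_X_le {σ ι : Type*} [Fintype ι] (c : ι → ℂ) (v : ι → σ) :
    (∑ j, c j • X (v j) : MvPolynomial σ ℂ).totalDegree ≤ 1 := by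
  refine totalDegree_finsetSum_le fun j _ => (totalDegree_smul_le _ _).trans ?_
  exact (totalDegree_X _).le

/-- **Rank–degree inequality for Brent refutations.** If the Brent system `B(n, r)` for `⟨n,n,n⟩`
has a Nullstellensatz refutation over `ℂ` with multipliers of total degree `≤ D`, then `r ≤ D`.
(Pull the symmetric pigeonhole design back along `a_{t,i} ↦ ∑_J x_J(i) p_{J,t}`; it kills every
`g · B_{ijk}` with `deg g < r`, so `D < r` would give `0 = 1`.) [folklore] -/
theorem le_of_brent_refutation (n r D : ℕ)
    (g : (Fin n × Fin n) → (Fin n × Fin n) → (Fin n × Fin n) →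
      MvPolynomial (Fin 3 × Fin r × (Fin n × Fin n)) ℂ)
    (hg : ∀ i j k, (g i j k).totalDegree ≤ D)
    (hsum : (∑ i, ∑ j, ∑ k, g i j k * ((∑ t : Fin r, MvPolynomial.X ((0 : Fin 3), t, i) *
      MvPolynomial.X ((1 : Fin 3), t, j) * MvPolynomial.X ((2 : Fin 3), t, k)) -
      MvPolynomial.C (Literature.Computability.AlgebraicComplexity.matMulTensor ℂ n n n i j k))) = 1) :
    r ≤ D := by
  classical
  by_contra hlt
  push Not at hlt
  obtain ⟨E, hE1, hcoll, hbool, hpig⟩ := exists_design (Fin n × Fin n × Fin n) r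
  -- coefficient vectors of the standard decomposition, and the substitution
  let cx : (Fin n × Fin n × Fin n) → (Fin n × Fin n) → ℂ := fun J a => if a = (J.1, J.2.2) then 1 else 0
  let cy : (Fin n × Fin n × Fin n) → (Fin n × Fin n) → ℂ := fun J b => if b = (J.1, J.2.1) then 1 else 0
  let cz : (Fin n × Fin n × Fin n) → (Fin n × Fin n) → ℂ := fun J c => if c = (J.2.1, J.2.2) then 1 else 0
  let co : Fin 3 → (Fin n × Fin n × Fin n) → (Fin n × Fin n) → ℂ := ![cx, cy, cz]
  let σ : Fin 3 × Fin r × (Fin n × Fin n) → MvPolynomial ((Fin n × Fin n × Fin n) × Fin r) ℂ :=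
    fun v => ∑ J, co v.1 J v.2.2 • X (J, v.2.1)
  set Φ : MvPolynomial (Fin 3 × Fin r × (Fin n × Fin n)) ℂ →ₐ[ℂ]
      MvPolynomial ((Fin n × Fin n × Fin n) × Fin r) ℂ := MvPolynomial.aeval σ with hΦ
  have hΦX : ∀ (s : Fin 3) (t : Fin r) (i : Fin n × Fin n),
      Φ (X (s, t, i)) = ∑ J, co s J i • X (J, t) := by
    intro s t i
    rw [hΦ, aeval_X]
  have hco : ∀ i j k : Fin n × Fin n, ∑ J, co 0 J i * co 1 J j * co 2 J k =
      Literature.Computability.AlgebraicComplexity.matMulTensor ℂ n n n i j k := by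
    intro i j k
    exact sum_std_triads n i j k
  have hdeg : ∀ i j k, ∀ μ ∈ (Φ (g i j k)).support, μ.support.card < r := by
    intro i j k μ hμ
    refine lt_of_le_of_lt ?_ hlt
    refine (Literature.Computability.AlgebraicComplexity.card_support_le_degree μ).trans
      ((le_totalDegree hμ).trans ?_)
    exact (Literature.Computability.AlgebraicComplexity.totalDegree_aeval_le_of_forall_le_one σ
      (fun v => totalDegree_sum_smul_X_le _ _) _).trans (hg i j k)
  have hkill : ∀ i j k, E (Φ (g i j k * ((∑ t : Fin r, X ((0 : Fin 3), t, i) *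
      X ((1 : Fin 3), t, j) * X ((2 : Fin 3), t, k)) -
      C (Literature.Computability.AlgebraicComplexity.matMulTensor ℂ n n n i j k)))) = 0 := by
    intro i j k
    rw [map_mul, map_sub, map_sum, mul_sub, map_sub]
    simp_rw [map_mul, hΦX]
    rw [design_master E hcoll hbool hpig _ (hdeg i j k), hco, aeval_C, MvPolynomial.algebraMap_eq,
      mul_comm (Φ (g i j k)), MvPolynomial.C_mul', map_smul, smul_eq_mul, sub_self]
  have h := congrArg (fun p => E (Φ p)) hsum
  simp only [map_sum, hkill, Finset.sum_const_zero, map_one, hE1] at h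
  exact zero_ne_one h

end NSDepth

/-- **Item `stmt-MatrixMultiplication-5586` (`NSDepthLowerBound`), proved unconditionally and in
the sharper form `r ≤ D`:** a Nullstellensatz refutation of the Brent system `B(n, r)` over `ℂ`
with multipliers of total degree `≤ D` forces `r ≤ 2 D + 5`. [folklore] -/
theorem NSDepthLowerBound_proof :
    Summit.MatrixMultiplication.MatrixMultiplication.Theses.BrentRefutationDepth.NSDepthLowerBound := by
  rintro n r D ⟨g, hg, hsum⟩
  have h := NSDepth.le_of_brent_refutation n r D g hg hsum
  omega

end Summit.MatrixMultiplication.MatrixMultiplication.Theorems
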